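import Summits.CriticalPhenomena.PercolationContinuityZ3.Theorems.PercNearOneGluingNearOneGluingKnLemma3i
import HarnessLib

/-!
# `NoHeavyLowerTail` (stmt-CriticalPhenomena-4575) — the PAIR-GAIN EXCHANGE: when two vertices are glued, the weaker one gains
# at least as much as any third vertex

Support file (lemma factory `prim-lf-3` gen 7, seat g9; `--supports stmt-CriticalPhenomena-4575`).  No definitions, no named
facts, no sorries.  Memo: `run/shared/lean/prim/prim-lf-3/LF3-BETA-R.md` §12 (LEMMA W): the inequality that controls the `j`-free
residual of the formal face of the `2 + (any law)` kernel (regime B), see `twoPortSide_reduction`.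

Setting: any weights `w` on the pairs of `Fin n`, vertices `b, p, p', z`.  If `μ(p ↔ b) ≤ μ(p' ↔ b)` then

  `μ(p ↔ b, p' ↮ b, p' ↔ z) ≤ μ(p' ↔ b, p ↮ b, p ↮ z)`                                   (`pairGain_exchange`).

Read as gains from adding a sure bond `pp'`: the LEFT event is exactly "`pp'` is pivotal for `z ↔ b` through `p`" minus nothing, and
`{p' ↔ b, p ↮ b}` is "`pp'` is pivotal for `p ↔ b`"; so the lemma says `gain_p(pp') − gain_z(pp') = RHS − LHS ≥ 0`: the WEAKER endpoint
of a glued pair gains at least as much connectivity to `b` as any other vertex.  (The anchored exchange `anchoredExchange` gives the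
same conclusion under `p ≤ z` instead of `p ≤ p'`.)
Proof: Kozma–Nitzan's Lemma 3(i) (`knLemma3i`, from the BHK two-cluster association) with the event `Q = {p' ↔ z}`, which is increasing
in the open edge cluster of `p'`: `μ(p ↔ b, Q) ≤ μ(p' ↔ b, Q)`; remove the common part `{p ↔ b, p' ↔ b, Q}` and use
`{p' ↔ b, p' ↔ z, p ↮ b} ⊆ {p' ↔ b, p ↮ b, p ↮ z}`.
-/

namespace Summit.CriticalPhenomena.PercolationContinuityZ3.Theorems

open MeasureTheory Set ProbabilityTheory
open Literature.Probability.LatticeModels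
open Literature.Probability.Percolation

noncomputable section
open Classical

namespace UpsetExchange

variable {n : ℕ}

/-- **Pair-gain exchange** (the weaker endpoint of a glued pair gains most).  See the module docstring.
[cite: KozmaNitzan2024, Lemma 3(i) (p. 6); VandenbergHaggstromKahn2005, Thm. 1.3] -/
theorem pairGain_exchange (w : Sym2 (Fin n) → unitInterval) (p p' z b : Fin n)
    (hyp : (prodBernoulli w).real (openConn p b) ≤ (prodBernoulli w).real (openConn p' b)) :
    (prodBernoulli w).real (openConn p b ∩ (openConn p' b)ᶜ ∩ openConn p' z) ≤
      (prodBernoulli w).real (openConn p' b ∩ (openConn p b)ᶜ ∩ (openConn p z)ᶜ) := by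
  set Q : Set (BondConfig (Fin n)) := openConn p' z with hQdef
  -- `Q` is increasing in the open edge cluster of `p'`
  have hQ : ∀ ω ω' : BondConfig (Fin n), ω ∈ Q → openEdgeCluster ω p' ⊆ openEdgeCluster ω' p' → ω' ∈ Q := by
    intro ω ω' hω hsub
    have h : (openGraph ω).Reachable p' z := hω
    have h' : (openGraph ω').Reachable p' z := by
      rw [reachable_iff_exists_mem_openEdgeCluster] at h ⊢
      rcases h with h | ⟨e, he, hze⟩
      · exact Or.inl h
      · exact Or.inr ⟨e, hsub he, hze⟩
    exact h'
  have key := knLemma3i n w p p' b Q 0 hQ le_rfl (by rw [add_zero]; exact hyp)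
  rw [zero_mul, add_zero] at key
  -- remove the common part `{p ↔ b} ∩ {p' ↔ b} ∩ Q`
  have hmeas : ∀ X : Set (BondConfig (Fin n)), MeasurableSet X := fun _ => MeasurableSet.of_discrete
  have hL := measureReal_inter_add_sdiff (μ := prodBernoulli w) (s := openConn p b ∩ Q) (hmeas (openConn p' b))
    (measure_ne_top _ _)
  have hR := measureReal_inter_add_sdiff (μ := prodBernoulli w) (s := openConn p' b ∩ Q) (hmeas (openConn p b))
    (measure_ne_top _ _)
  have hZ : openConn p b ∩ Q ∩ openConn p' b = openConn p' b ∩ Q ∩ openConn p b := by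
    ext ω; simp only [mem_inter_iff]; tauto
  have h1 : (openConn p b ∩ Q) \ openConn p' b = openConn p b ∩ (openConn p' b)ᶜ ∩ openConn p' z := by
    ext ω; simp only [hQdef, mem_sdiff, mem_inter_iff, mem_compl_iff]; tauto
  have h2 : (prodBernoulli w).real ((openConn p' b ∩ Q) \ openConn p b) ≤
      (prodBernoulli w).real (openConn p' b ∩ (openConn p b)ᶜ ∩ (openConn p z)ᶜ) := by
    apply measureReal_mono
    · rintro ω ⟨⟨hp'b, hp'z⟩, hpb⟩
      refine ⟨⟨hp'b, hpb⟩, fun hpz => hpb ?_⟩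
      exact ((hpz : (openGraph ω).Reachable p z).trans (hp'z : (openGraph ω).Reachable p' z).symm).trans
        (hp'b : (openGraph ω).Reachable p' b)
    · exact measure_ne_top _ _
  rw [hZ] at hL
  rw [← h1]
  linarith

/-- The same in GAIN form: `gain_z(pp') ≤ gain_p(pp')`, where the gain of `x` from the sure bond `pp'` is the probability that `pp'` is
pivotal for `x ↔ b`: for `p` this is `{p' ↔ b, p ↮ b}`, for `z` it is `{z ↮ b} ∩ ({z ↔ p, p' ↔ b} ∪ {z ↔ p', p ↔ b})`. [folklore] -/
theorem pairGain_le (w : Sym2 (Fin n) → unitInterval) (p p' z b : Fin n)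
    (hyp : (prodBernoulli w).real (openConn p b) ≤ (prodBernoulli w).real (openConn p' b)) :
    (prodBernoulli w).real ((openConn z b)ᶜ ∩ (openConn z p ∩ openConn p' b ∪ openConn z p' ∩ openConn p b)) ≤
      (prodBernoulli w).real (openConn p' b ∩ (openConn p b)ᶜ) := by
  have hx := pairGain_exchange w p p' z b hyp
  have hmeas : ∀ X : Set (BondConfig (Fin n)), MeasurableSet X := fun _ => MeasurableSet.of_discrete
  -- split the pivotality event of `z` along `{z ↔ p}`
  have hsplit : (openConn z b)ᶜ ∩ (openConn z p ∩ openConn p' b ∪ openConn z p' ∩ openConn p b) =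
      (openConn p' b ∩ (openConn p b)ᶜ ∩ openConn z p) ∪ (openConn p b ∩ (openConn p' b)ᶜ ∩ openConn p' z) := by
    ext ω
    simp only [mem_inter_iff, mem_union, mem_compl_iff]
    constructor
    · rintro ⟨hzb, (⟨hzp, hp'b⟩ | ⟨hzp', hpb⟩)⟩
      · exact Or.inl ⟨⟨hp'b, fun hpb => hzb ((hzp : (openGraph ω).Reachable z p).trans hpb)⟩, hzp⟩
      · refine Or.inr ⟨⟨hpb, fun hp'b => hzb ((hzp' : (openGraph ω).Reachable z p').trans hp'b)⟩, ?_⟩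
        exact (hzp' : (openGraph ω).Reachable z p').symm
    · rintro (⟨⟨hp'b, hpb⟩, hzp⟩ | ⟨⟨hpb, hp'b⟩, hp'z⟩)
      · exact ⟨fun hzb => hpb ((hzp : (openGraph ω).Reachable z p).symm.trans hzb), Or.inl ⟨hzp, hp'b⟩⟩
      · refine ⟨fun hzb => hp'b ((hp'z : (openGraph ω).Reachable p' z).trans hzb), Or.inr ⟨?_, hpb⟩⟩
        exact (hp'z : (openGraph ω).Reachable p' z).symm
  rw [hsplit]
  have hdisj : Disjoint (openConn p' b ∩ (openConn p b)ᶜ ∩ openConn z p)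
      (openConn p b ∩ (openConn p' b)ᶜ ∩ openConn p' z) := by
    rw [Set.disjoint_left]
    rintro ω ⟨⟨_, hpb⟩, _⟩ ⟨⟨hpb', _⟩, _⟩
    exact hpb hpb'
  rw [measureReal_union hdisj (hmeas _)]
  -- the gain of `p` splits along `{z ↔ p}` as well
  have hP := measureReal_inter_add_sdiff (μ := prodBernoulli w) (s := openConn p' b ∩ (openConn p b)ᶜ) (hmeas (openConn z p))
    (measure_ne_top _ _)
  have h3 : (openConn p' b ∩ (openConn p b)ᶜ) \ openConn z p = openConn p' b ∩ (openConn p b)ᶜ ∩ (openConn p z)ᶜ := by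
    ext ω
    simp only [mem_sdiff, mem_inter_iff, mem_compl_iff]
    constructor
    · rintro ⟨⟨h1, h2⟩, h3⟩; exact ⟨⟨h1, h2⟩, fun h => h3 (h : (openGraph ω).Reachable p z).symm⟩
    · rintro ⟨⟨h1, h2⟩, h3⟩; exact ⟨⟨h1, h2⟩, fun h => h3 (h : (openGraph ω).Reachable z p).symm⟩
  rw [h3] at hP
  linarith

end UpsetExchange

end

end Summit.CriticalPhenomena.PercolationContinuityZ3.Theorems
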